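import Summits.ResolutionOfSingularities.ResolutionOfSingularities.Theorems.PurelyInseparableDim4ResConeLightSlices
import Summits.ResolutionOfSingularities.ResolutionOfSingularities.Theorems.PurelyInseparableDim4ShadeTwoSwapWindow
import HarnessLib
import HarnessLib.Audit.Tags

/-!
# Purely inseparable four-folds — THE LOCATED RESIDUE OF K2(p) HAS SHADE AT LEAST 3
# (cell `res-dim4-pi`, K2(p) lane, slice B, brick K14b)

[OURS · counted 0 · cell `res-dim4-pi` · K2(p) lane holder res-dim4-p-12 g3 (bus 2026-08-29 04:22Z).]  Nothing here proves
K2(p)/K2(5), `NoIsolatedTrap p p` or resolution of singularities in dimension ≥ 4 / characteristic `p`.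

The board sentence of record `ResCone.noAboveFloorTrap_iff_lightSlices` (K14, res-dim4-p-2) reads: for every prime `p`,
`RidgeBudget.NoAboveFloorTrap p p` iff over every field of characteristic `p` there is no LIGHT power-cone trap (constant
shade `2 ≤ d < p`, `e_G ≡ 3`, returning to light satellite steps) and no binary-cone trap (constant shade `2 ≤ d < p`,
`e_G ≡ 2`).  res-dim4-p-7 g3's `ResCone.no_isolated_shadeTwo_trap` (the `d = 2` phase, twenty files, unconditional for
every prime) kills every isolated above-floor chain of constant shade `2`, whatever its cone.  This file records the
sharpened sentence: **both slices may be restricted to shade `3 ≤ d`** (`noAboveFloorTrap_iff_lightSlices_three`), and at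
`p = 5` to `d ∈ {3, 4}` (`noAboveFloorTrap_five_iff_lightSlices_three`).

bears_on: LADDER-RESOLUTION:D157-DOOR2 (res-dim4-pi · K2(p) · slice B · K14b).  Supports
stmt-ResolutionOfSingularities-16155 (helper).
-/

set_option linter.dupNamespace false -- mandated namespace of this single-conjunct summit

namespace Summit.ResolutionOfSingularities.ResolutionOfSingularities.Theorems.PIDim4

namespace ResCone

open MvPolynomial
open Literature.AlgebraicGeometry.Resolution
open Literature.AlgebraicGeometry.Resolution.CentreBlowup
open Literature.AlgebraicGeometry.Resolution.Hauser2010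
open Literature.AlgebraicGeometry.Resolution.HauserPerlega2019
open RidgeBudget (NoAboveFloorTrap)

/-- **The shade-`2` slices are empty** (projection of any constant-shade-`2` slice onto p-7's theorem): an isolated
above-floor `Step0 p` chain with `x^{r₀} ∣ F₀` and constant shade `(2 : ℕ)` does not exist, whatever else is asked of it.
[OURS · bookkeeping] [cite: CossartJannsenSaito2020, Thm. 3.14] -/
theorem no_isolated_chain_of_shade_eq_two (p : ℕ) [Fact p.Prime] (K : Type) [Field K] [CharP K p] [DecidableEq K]
    {c : ℕ → State K} (hr0 : ∀ e ∈ (c 0).F.support, (c 0).r ≤ e)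
    (hc : ∀ k, IsIsolated p (c k).F ∧ Step0 p (c k) (c (k + 1)) ∧ ordZero (c k).F ≠ p ∧
      (c k).shade = ((2 : ℕ) : ℕ∞)) : False :=
  no_isolated_shadeTwo_trap p K ⟨c, hr0, fun k => by
    obtain ⟨h1, h2, h3, h4⟩ := hc k
    exact ⟨h1, h2, h3, by rw [h4]; rfl⟩⟩

/-- **K14b. THE LOCATED RESIDUE HAS SHADE ≥ 3**: for every prime `p`, `RidgeBudget.NoAboveFloorTrap p p` holds iff over
every field of characteristic `p` there is (B-light) no isolated above-floor witnessed `Step0 p` chain with `x^{r₀} ∣ F₀`,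
constant shade `3 ≤ d < p` and `e_G ≡ 3` returning beyond every index to a satellite step with `o_k + o_{k+1} + 3 ≤ 3p`,
and (C) no isolated above-floor chain with constant shade `3 ≤ d < p` and `e_G ≡ 2` — the shade-`2` slices of K14 being
empty by `no_isolated_shadeTwo_trap`. [OURS] [cite: CossartJannsenSaito2020, Thm. 3.14] -/
theorem noAboveFloorTrap_iff_lightSlices_three (p : ℕ) [Fact p.Prime] :
    NoAboveFloorTrap p p ↔ ∀ (K : Type) [Field K] [CharP K p] [DecidableEq K],
      (¬ ∃ (c : ℕ → State K) (d : ℕ) (j : ℕ → Fin 4) (b : ℕ → Fin 4 → K), 3 ≤ d ∧ d < p ∧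
          (∀ e' ∈ (c 0).F.support, (c 0).r ≤ e') ∧ FreeTail.IsWitnessedChain p c j b ∧
          (∀ k, IsIsolated p (c k).F ∧ Step0 p (c k) (c (k + 1)) ∧ ordZero (c k).F ≠ p ∧
            (c k).shade = (d : ℕ∞) ∧ Module.finrank K (resVertex (c k)) = 3) ∧
          ∀ N, ∃ k, N ≤ k ∧ FreeTail.IsSatellite j b k ∧
            (ordZero (c k).F).toNat + (ordZero (c (k + 1)).F).toNat + 3 ≤ 3 * p) ∧
      (¬ ∃ (c : ℕ → State K) (d : ℕ), 3 ≤ d ∧ d < p ∧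
          (∀ e' ∈ (c 0).F.support, (c 0).r ≤ e') ∧
          ∀ k, IsIsolated p (c k).F ∧ Step0 p (c k) (c (k + 1)) ∧ ordZero (c k).F ≠ p ∧
            (c k).shade = (d : ℕ∞) ∧ Module.finrank K (resVertex (c k)) = 2) := by
  rw [noAboveFloorTrap_iff_lightSlices p]
  refine forall_congr' fun K => forall_congr' fun _ => forall_congr' fun _ => forall_congr' fun _ => ?_
  refine and_congr ⟨fun h => ?_, fun h => ?_⟩ ⟨fun h => ?_, fun h => ?_⟩
  · rintro ⟨c, d, j, b, h3d, hdp, hr0, hw, hc, hsat⟩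
    exact h ⟨c, d, j, b, by omega, hdp, hr0, hw, hc, hsat⟩
  · rintro ⟨c, d, j, b, h2d, hdp, hr0, hw, hc, hsat⟩
    by_cases hd : d = 2
    · subst hd
      exact no_isolated_chain_of_shade_eq_two p K hr0 fun k =>
        ⟨(hc k).1, (hc k).2.1, (hc k).2.2.1, (hc k).2.2.2.1⟩
    · exact h ⟨c, d, j, b, by omega, hdp, hr0, hw, hc, hsat⟩
  · rintro ⟨c, d, h3d, hdp, hr0, hc⟩
    exact h ⟨c, d, by omega, hdp, hr0, hc⟩
  · rintro ⟨c, d, h2d, hdp, hr0, hc⟩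
    by_cases hd : d = 2
    · subst hd
      exact no_isolated_chain_of_shade_eq_two p K hr0 fun k =>
        ⟨(hc k).1, (hc k).2.1, (hc k).2.2.1, (hc k).2.2.2.1⟩
    · exact h ⟨c, d, by omega, hdp, hr0, hc⟩

/-- **K14b at `p = 5`: K2(5) ⟺ no power-cone trap of shade `3` or `4` returning infinitely often to a satellite step at
orders `(6, 6)` ∧ no binary-cone trap of shade `3` or `4`.** [OURS] [cite: CossartJannsenSaito2020, Thm. 3.14] -/
theorem noAboveFloorTrap_five_iff_lightSlices_three :
    NoAboveFloorTrap 5 5 ↔ ∀ (K : Type) [Field K] [CharP K 5] [DecidableEq K],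
      (¬ ∃ (c : ℕ → State K) (d : ℕ) (j : ℕ → Fin 4) (b : ℕ → Fin 4 → K), 3 ≤ d ∧ d ≤ 4 ∧
          (∀ e' ∈ (c 0).F.support, (c 0).r ≤ e') ∧ FreeTail.IsWitnessedChain 5 c j b ∧
          (∀ k, IsIsolated 5 (c k).F ∧ Step0 5 (c k) (c (k + 1)) ∧ ordZero (c k).F ≠ (5 : ℕ) ∧
            (c k).shade = (d : ℕ∞) ∧ Module.finrank K (resVertex (c k)) = 3) ∧
          ∀ N, ∃ k, N ≤ k ∧ FreeTail.IsSatellite j b k ∧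
            ordZero (c k).F = (6 : ℕ) ∧ ordZero (c (k + 1)).F = (6 : ℕ)) ∧
      (¬ ∃ (c : ℕ → State K) (d : ℕ), 3 ≤ d ∧ d ≤ 4 ∧
          (∀ e' ∈ (c 0).F.support, (c 0).r ≤ e') ∧
          ∀ k, IsIsolated 5 (c k).F ∧ Step0 5 (c k) (c (k + 1)) ∧ ordZero (c k).F ≠ (5 : ℕ) ∧
            (c k).shade = (d : ℕ∞) ∧ Module.finrank K (resVertex (c k)) = 2) := by
  haveI : Fact (Nat.Prime 5) := ⟨by norm_num⟩
  rw [noAboveFloorTrap_five_iff_lightSlices]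
  refine forall_congr' fun K => forall_congr' fun _ => forall_congr' fun _ => forall_congr' fun _ => ?_
  refine and_congr ⟨fun h => ?_, fun h => ?_⟩ ⟨fun h => ?_, fun h => ?_⟩
  · rintro ⟨c, d, j, b, h3d, hd4, hr0, hw, hc, hsat⟩
    exact h ⟨c, d, j, b, by omega, hd4, hr0, hw, hc, hsat⟩
  · rintro ⟨c, d, j, b, h2d, hd4, hr0, hw, hc, hsat⟩
    by_cases hd : d = 2
    · subst hd
      exact no_isolated_chain_of_shade_eq_two 5 K hr0 fun k =>
        ⟨(hc k).1, (hc k).2.1, by exact_mod_cast (hc k).2.2.1, (hc k).2.2.2.1⟩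
    · exact h ⟨c, d, j, b, by omega, hd4, hr0, hw, hc, hsat⟩
  · rintro ⟨c, d, h3d, hd4, hr0, hc⟩
    exact h ⟨c, d, by omega, hd4, hr0, hc⟩
  · rintro ⟨c, d, h2d, hd4, hr0, hc⟩
    by_cases hd : d = 2
    · subst hd
      exact no_isolated_chain_of_shade_eq_two 5 K hr0 fun k =>
        ⟨(hc k).1, (hc k).2.1, by exact_mod_cast (hc k).2.2.1, (hc k).2.2.2.1⟩
    · exact h ⟨c, d, by omega, hd4, hr0, hc⟩

end ResCone

end Summit.ResolutionOfSingularities.ResolutionOfSingularities.Theorems.PIDim4
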